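import Summits.ResolutionOfSingularities.ResolutionOfSingularities.Theorems.PinchTowerTau
import Literature.AlgebraicGeometry.Resolution.RegularLocalRingsNormal

/-!
# SplitTower (T1/·) — graded kernels: unit coefficients force high weights; THE FIBRE-LINE EXIT

Node «SplitTower» of `decomp-res-lens-2` (g34), see `Theorems/MaxContactCutSplitTower.lean`: the hypothesis-free proof
of the engine letter `SplitCut.SplitConeExit` by the tower of blow-ups of the section curves of a split cone.

This slice is pure commutative algebra in a regular local ring `(A, 𝔪, κ)`:

* `eval_sub_homogeneousComponent_mem`, `le_degree_of_isUnit_coeff` [GRADED KERNEL]: if a polynomial `P` whose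
  non-zero coefficients are UNITS evaluates at a minimal basis of `𝔪` into `𝔪ᴺ`, then every monomial of `P` has
  degree `≥ N` (`gr_𝔪 A = κ[X]`, Matsumura 17.10, read through `map_residue_eq_zero_of_eval_mem_pow_succ`);
* `coeff_C_mul_X_add_C_pow`, `coeff_eq_of_comp_X_add_C` [UNIVARIATE KERNEL]: a polynomial of degree `≤ n` whose
  translate by `α` is divisible by `Xⁿ` is `c·(X − α)ⁿ`, coefficientwise;
* `fibreLine_two_le_tau` [THE FIBRE-LINE EXIT]: for a part `(t, p, x₀)` of a regular system of parameters and
  `F = Σ_{i ≤ n} wᵢ p^{mᵢ} x₀^{n−i} + t·r ∈ J ⊆ 𝔪ⁿ` with every `wᵢ` zero or a unit and one `j < n` with `w_j` a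
  unit, `m_j ≤ j` and `C(n, j) ∈ 𝔪`, one has `τ(J, n) ≥ 2`: the graded kernel forces `mᵢ ≥ i`, so modulo `t`
  the initial form of `F` contains the monomial `w_j p^j x₀^{n−j}` (and `x₀ⁿ` when `w₀ = 1`, `m₀ = 0`); were
  `τ ≤ 1` it would be `c·ℓⁿ`, and comparing the coefficients of `pʲx₀ⁿ⁻ʲ` in `κ[p, x₀]` (after killing the other
  variables) gives `w̄_j = c̄·C(n, j)·b₀ʲb₁ⁿ⁻ʲ = 0`, a contradiction. This is the exit at every point of the
  exceptional fibre line over a core point of the split-cone curve except its section point.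

Sources: [Matsumura1987] Thm. 14.2, 17.10; [Hironaka1964] Ch. III §3; [CossartPiltant2008] Prop. 4.2.
-/

open IsLocalRing
open Literature.AlgebraicGeometry.Resolution

namespace Summit.ResolutionOfSingularities.ResolutionOfSingularities.Theorems.SplitTower

/-! ## §G  The graded kernel -/

section Graded

open MvPolynomial

/-- If every monomial of `P` has degree `≥ N`, then `P` minus its degree-`N` component evaluates into
`(x)ᴺ⁺¹`. [folklore] -/
theorem eval_sub_homogeneousComponent_mem {R : Type} [CommRing R] {d : ℕ} (x : Fin d → R)
    {P : MvPolynomial (Fin d) R} {N : ℕ} (hN : ∀ m ∈ P.support, N ≤ m.degree) :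
    eval x (P - homogeneousComponent N P) ∈ Ideal.span (Set.range x) ^ (N + 1) := by
  classical
  have hsub : Finset.range (P.totalDegree + 1) ⊆ Finset.range (P.totalDegree + N + 1) :=
    fun i hi => Finset.mem_range.2 ((Finset.mem_range.1 hi).trans_le
      (Nat.add_le_add_right (Nat.le_add_right _ N) 1))
  have hsum : ∑ i ∈ Finset.range (P.totalDegree + N + 1), homogeneousComponent i P = P := by
    have h := sum_homogeneousComponent P
    rwa [Finset.sum_subset hsub (fun i _ hi' => homogeneousComponent_eq_zero _ _
      (by have h2 : ¬ i < P.totalDegree + 1 := fun h' => hi' (Finset.mem_range.2 h'); omega))] at h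
  have hmem : N ∈ Finset.range (P.totalDegree + N + 1) := Finset.mem_range.2 (by omega)
  rw [← Finset.sum_erase_add _ _ hmem] at hsum
  have hPQ : P - homogeneousComponent N P =
      ∑ i ∈ (Finset.range (P.totalDegree + N + 1)).erase N, homogeneousComponent i P :=
    sub_eq_of_eq_add hsum.symm
  rw [hPQ, map_sum]
  refine Ideal.sum_mem _ fun i hi => ?_
  obtain ⟨hne, -⟩ := Finset.mem_erase.1 hi
  rcases lt_or_gt_of_ne hne with hlt | hgt
  · rw [homogeneousComponent_eq_zero' _ _ (fun m hm => by have := hN m hm; omega), map_zero]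
    exact Ideal.zero_mem _
  · exact Ideal.pow_le_pow_right (by omega) (eval_mem_span_pow x (homogeneousComponent_isHomogeneous i P))

variable {R : Type} [CommRing R] [IsRegularLocalRing R]
variable {d : ℕ} (hd : (maximalIdeal R).spanFinrank = d)
  (x : Fin d → R) (hx : Ideal.span (Set.range x) = maximalIdeal R)
include hd hx

/-- **Graded kernel**: in a regular local ring, if a polynomial all of whose non-zero coefficients are units
evaluates at a minimal basis of `𝔪` into `𝔪ᴺ`, then all its monomials have degree `≥ N` (induction on `N`:
the degree-`N` component reduces to `0` in `gr_𝔪 A = κ[X]` by Matsumura 17.10, but its coefficients are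
units). [cite: Matsumura1987, Thm. 17.10] -/
theorem le_degree_of_isUnit_coeff {P : MvPolynomial (Fin d) R} (hP : ∀ m ∈ P.support, IsUnit (P.coeff m))
    {N : ℕ} (h : eval x P ∈ maximalIdeal R ^ N) : ∀ m ∈ P.support, N ≤ m.degree := by
  classical
  induction N with
  | zero => exact fun _ _ => Nat.zero_le _
  | succ N ih =>
    have hN : ∀ m ∈ P.support, N ≤ m.degree := ih (Ideal.pow_le_pow_right (Nat.le_succ N) h)
    suffices hne : ∀ m ∈ P.support, m.degree ≠ N by
      intro m hm
      exact Nat.succ_le_of_lt (lt_of_le_of_ne (hN m hm) (fun h => hne m hm h.symm))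
    intro m hm heq
    have hPQ := eval_sub_homogeneousComponent_mem x hN
    rw [hx] at hPQ
    have hQ : eval x (homogeneousComponent N P) ∈ maximalIdeal R ^ (N + 1) := by
      have := Ideal.sub_mem _ h hPQ
      rwa [map_sub, sub_sub_cancel] at this
    have h0 := map_residue_eq_zero_of_eval_mem_pow_succ hd x hx (homogeneousComponent_isHomogeneous N P) hQ
    have hc : residue R (P.coeff m) = 0 := by
      have := congrArg (coeff m) h0
      rwa [coeff_map, coeff_zero, coeff_homogeneousComponent, if_pos heq] at this
    rw [residue_eq_zero_iff] at hc
    exact (notMem_maximalIdeal.2 (hP m hm)) hc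

end Graded

/-! ## §U  The univariate kernel -/

section Univariate

open Polynomial

/-- Coefficients of `(aX + b)ⁿ`. [folklore] -/
theorem coeff_C_mul_X_add_C_pow {K : Type} [CommRing K] (a b : K) (n : ℕ) {j : ℕ} (hj : j ≤ n) :
    ((C a * X + C b) ^ n).coeff j = a ^ j * b ^ (n - j) * (n.choose j : K) := by
  rw [add_pow, finsetSum_coeff]
  have : ∀ m : ℕ, (C a * X) ^ m * C b ^ (n - m) * (n.choose m : K[X]) =
      C (a ^ m * b ^ (n - m) * (n.choose m : K)) * X ^ m := fun m => by
    simp only [mul_pow, map_mul, map_pow, map_natCast]; ring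
  simp_rw [this, coeff_C_mul_X_pow]
  rw [Finset.sum_eq_single j]
  · rw [if_pos rfl]
  · intro m _ hm; rw [if_neg (Ne.symm hm)]
  · intro h; exact absurd (Finset.mem_range.2 (Nat.lt_succ_of_le hj)) h

/-- **Univariate kernel**: over a field, a polynomial `P` of degree `≤ n` whose translate `P(X + α)` has no terms
of degree `< n` is `c·(X − α)ⁿ` with `c` the `Xⁿ`-coefficient of the translate — coefficientwise. [folklore] -/
theorem coeff_eq_of_comp_X_add_C {K : Type} [Field K] {P : K[X]} {n : ℕ} (hP : P.natDegree ≤ n) (α : K)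
    (h : ∀ i < n, (P.comp (X + C α)).coeff i = 0) (i : ℕ) :
    P.coeff i = (P.comp (X + C α)).coeff n * ((-α) ^ (n - i) * (n.choose i : K)) := by
  set Q := P.comp (X + C α) with hQ
  have hQdeg : Q.natDegree ≤ n :=
    natDegree_comp_le.trans (by rw [natDegree_X_add_C, mul_one]; exact hP)
  have hQeq : Q = C (Q.coeff n) * X ^ n := by
    ext l
    rw [coeff_C_mul_X_pow]
    split_ifs with hl
    · rw [hl]
    · rcases lt_or_gt_of_ne hl with hlt | hgt
      · exact h l hlt
      · exact coeff_eq_zero_of_natDegree_lt (lt_of_le_of_lt hQdeg hgt)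
  have hPQ : P = Q.comp (X - C α) := by
    rw [hQ, comp_assoc, add_comp, X_comp, C_comp, sub_add_cancel, comp_X]
  have hXa : (X - C α : K[X]) = X + C (-α) := by rw [map_neg, sub_eq_add_neg]
  conv_lhs => rw [hPQ, hQeq, mul_comp, C_comp, X_pow_comp, coeff_C_mul, hXa, coeff_X_add_C_pow]

end Univariate

/-! ## §F  THE FIBRE-LINE EXIT -/

section FibreLine

open MvPolynomial

variable {A : Type} [CommRing A] [IsLocalRing A] [IsNoetherianRing A]

/-- `Fin.append ![t] ![p, x₀] = ![t, p, x₀]`. [folklore] -/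
theorem fin_append_one_two {α : Type} (t p x₀ : α) : Fin.append ![t] ![p, x₀] = ![t, p, x₀] := by
  funext i; fin_cases i <;> rfl

/-- **THE FIBRE-LINE EXIT.** Let `(t, p, x₀)` be part of a regular system of parameters of `A` and
`F = Σ_{i ≤ n} wᵢ·p^{mᵢ}·x₀^{n−i} + t·r ∈ J ⊆ 𝔪ⁿ` with every `wᵢ` zero or a unit and one index `j < n` with
`w_j` a unit, `m_j ≤ j` and `C(n, j) ∈ 𝔪` (in the application `w₀ = 1`, `m₀ = 0` and `0 < j`). Then `τ(J, n) ≥ 2` (for every minimal basis `y` of `𝔪`).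
Proof: modulo `t` (a regular local ring with `(p̄, x̄₀)` part of a minimal basis `ȳ`), `F̄ = P(ȳ)` for the polynomial
`P = Σ wᵢ Y₀^{mᵢ} Y₁^{n−i}` with unit coefficients, so the graded kernel gives `mᵢ ≥ i` whenever `wᵢ` is a unit;
were `τ ≤ 1`, `F ≡ c·ℓⁿ (mod 𝔪ⁿ⁺¹)` (`exists_sub_mem_pow_succ_of_tau_le_one`), hence the degree-`n` part `Pₙ`
of `P` (the terms with `mᵢ = i`, among them `Y₁ⁿ` and `w_j Y₀ʲY₁ⁿ⁻ʲ`) satisfies `Pₙ ≡ c̄·(Σ bᵢYᵢ)ⁿ` in `κ[Y]`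
(Matsumura 17.10); substituting `Y₀ ↦ X`, `Y₁ ↦ 1`, `Yᵢ ↦ 0` and reading off the `Xʲ`-coefficient gives
`w̄_j = c̄·b̄₀ʲ·b̄₁ⁿ⁻ʲ·C(n, j) = 0`, contradicting `w_j ∈ A×`.
[cite: Matsumura1987, Thm. 14.2, 17.10; Hironaka1964, Ch. III §3] -/
theorem fibreLine_two_le_tau {t p x₀ r : A} (htpx : IsRsopPart ![t, p, x₀]) {n : ℕ} (hn : 1 ≤ n)
    (w : ℕ → A) (m : ℕ → ℕ) (hw : ∀ i, w i = 0 ∨ IsUnit (w i))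
    {j : ℕ} (hjn : j < n) (hwj : IsUnit (w j)) (hmj : m j ≤ j)
    (hguard : ((n.choose j : ℕ) : A) ∈ maximalIdeal A)
    {J : Ideal A} (hJ : J ≤ maximalIdeal A ^ n)
    (hF : (∑ i ∈ Finset.range (n + 1), w i * p ^ m i * x₀ ^ (n - i)) + t * r ∈ J)
    {d : ℕ} (y : Fin d → A) (hy : Ideal.span (Set.range y) = maximalIdeal A) :
    2 ≤ hironakaTauAt y J n := by
  classical
  haveI : IsRegularLocalRing A := htpx.isRegularLocalRing
  by_contra hlt
  have hτ : hironakaTauAt y J n ≤ 1 := by omega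
  obtain ⟨c, a, hca⟩ := PinchTower.exists_sub_mem_pow_succ_of_tau_le_one y hy hn hτ hF (hJ hF)
  -- pass to `Ā = A/(t)`
  set K : Ideal A := Ideal.span (Set.range ![t]) with hK
  have hKle : K ≤ maximalIdeal A := by
    rw [hK, Ideal.span_le]
    rintro _ ⟨l, rfl⟩
    fin_cases l
    exact htpx.mem_maximalIdeal 0
  haveI : IsLocalRing (A ⧸ K) := PinchTower.isLocalRing_quotient hKle
  have htK : Ideal.Quotient.mk K t = 0 := Ideal.Quotient.eq_zero_iff_mem.2 (Ideal.subset_span ⟨0, rfl⟩)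
  have hpx : IsRsopPart (fun l => Ideal.Quotient.mk K (![p, x₀] l)) := by
    have h3 : IsRsopPart (Fin.append ![t] ![p, x₀]) := by rw [fin_append_one_two]; exact htpx
    exact PinchTower.isRsopPart_tail_quotient h3
  haveI : IsRegularLocalRing (A ⧸ K) := hpx.isRegularLocalRing
  obtain ⟨e, yb, hdim, hyb, hybz⟩ := hpx.exists_rsop
  have hy0 : yb (Fin.castAdd e 0) = Ideal.Quotient.mk K p := (hybz 0).trans rfl
  have hy1 : yb (Fin.castAdd e 1) = Ideal.Quotient.mk K x₀ := (hybz 1).trans rfl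
  have hi : (Fin.castAdd e 0 : Fin (2 + e)) ≠ Fin.castAdd e 1 := fun h =>
    absurd (Fin.castAdd_injective _ _ h) (by decide)
  -- images of powers of `𝔪`
  have hmK : ∀ {z : A} {N : ℕ}, z ∈ maximalIdeal A ^ N → Ideal.Quotient.mk K z ∈ maximalIdeal (A ⧸ K) ^ N := by
    intro z N hz
    have := Ideal.mem_map_of_mem (Ideal.Quotient.mk K) hz
    rwa [Ideal.map_pow, PinchTower.map_mk_maximalIdeal_eq] at this
  -- the polynomial `P`
  set s : ℕ → (Fin (2 + e) →₀ ℕ) := fun i =>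
    Finsupp.single (Fin.castAdd e 0) (m i) + Finsupp.single (Fin.castAdd e 1) (n - i) with hs
  set W : ℕ → A ⧸ K := fun i => Ideal.Quotient.mk K (w i) with hW
  set P : MvPolynomial (Fin (2 + e)) (A ⧸ K) := ∑ i ∈ Finset.range (n + 1), monomial (s i) (W i) with hP
  have hs1 : ∀ i, s i (Fin.castAdd e 1) = n - i := fun i => by
    simp only [hs, Finsupp.add_apply, Finsupp.single_eq_same, Finsupp.single_eq_of_ne' hi, zero_add]
  have hs0 : ∀ i, s i (Fin.castAdd e 0) = m i := fun i => by
    simp only [hs, Finsupp.add_apply, Finsupp.single_eq_same, Finsupp.single_eq_of_ne' hi.symm, add_zero]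
  have hsdeg : ∀ i, (s i).degree = m i + (n - i) := fun i => by
    simp only [hs, map_add, Finsupp.degree_single]
  have hs_inj : ∀ i ≤ n, ∀ i' ≤ n, s i = s i' → i = i' := by
    intro i hi i' hi' h
    have := congrArg (fun f => f (Fin.castAdd e 1)) h
    simp only [hs1] at this
    omega
  have hcoeff : ∀ i ≤ n, P.coeff (s i) = W i := by
    intro i hi
    rw [hP, coeff_sum, Finset.sum_eq_single i]
    · rw [coeff_monomial, if_pos rfl]
    · intro i' hi' hne
      rw [coeff_monomial, if_neg]
      exact fun h => hne (hs_inj i' (Nat.lt_succ_iff.1 (Finset.mem_range.1 hi')) i hi h)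
    · intro h; exact absurd (Finset.mem_range.2 (Nat.lt_succ_of_le hi)) h
  have hcoeff0 : ∀ mo, (∀ i ≤ n, s i ≠ mo) → P.coeff mo = 0 := by
    intro mo hmo
    rw [hP, coeff_sum]
    refine Finset.sum_eq_zero fun i hi => ?_
    rw [coeff_monomial, if_neg (hmo i (Nat.lt_succ_iff.1 (Finset.mem_range.1 hi)))]
  have hsupp : ∀ mo ∈ P.support, ∃ i ≤ n, s i = mo ∧ IsUnit (W i) := by
    intro mo hmo
    rw [mem_support_iff] at hmo
    by_cases hex : ∃ i ≤ n, s i = mo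
    · obtain ⟨i, hi, rfl⟩ := hex
      refine ⟨i, hi, rfl, ?_⟩
      rw [hcoeff i hi] at hmo
      rcases hw i with h0 | hu
      · exact absurd (by rw [hW]; simp only [h0, map_zero]) hmo
      · exact hu.map _
    · push Not at hex
      exact absurd (hcoeff0 mo hex) hmo
  have hunit : ∀ mo ∈ P.support, IsUnit (P.coeff mo) := by
    intro mo hmo
    obtain ⟨i, hi, rfl, hu⟩ := hsupp mo hmo
    rwa [hcoeff i hi]
  -- evaluation: `P(ȳ) = F̄`
  set F := (∑ i ∈ Finset.range (n + 1), w i * p ^ m i * x₀ ^ (n - i)) + t * r with hFdef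
  have hevmono : ∀ i, eval yb (monomial (s i) (W i)) =
      W i * Ideal.Quotient.mk K p ^ m i * Ideal.Quotient.mk K x₀ ^ (n - i) := by
    intro i
    rw [show monomial (s i) (W i) = C (W i) * X (Fin.castAdd e 0) ^ m i * X (Fin.castAdd e 1) ^ (n - i) by
      rw [hs, C_mul_X_pow_eq_monomial, X_pow_eq_monomial, monomial_mul, mul_one]]
    simp only [map_mul, map_pow, eval_C, eval_X, hy0, hy1]
  have hevalP : eval yb P = Ideal.Quotient.mk K F := by
    rw [hP, map_sum, hFdef, map_add, map_mul, htK, zero_mul, add_zero, map_sum]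
    refine Finset.sum_congr rfl fun i _ => ?_
    rw [hevmono, map_mul, map_mul, map_pow, map_pow]
  -- graded kernel: `mᵢ ≥ i` for unit `wᵢ`
  have hFn : eval yb P ∈ maximalIdeal (A ⧸ K) ^ n := by rw [hevalP]; exact hmK (hJ hF)
  have hdeg := le_degree_of_isUnit_coeff hdim yb hyb hunit hFn
  have hmi : ∀ i ≤ n, IsUnit (w i) → i ≤ m i := by
    intro i hi hu
    have hmem : s i ∈ P.support := by
      rw [mem_support_iff, hcoeff i hi]
      exact (hu.map (Ideal.Quotient.mk K)).ne_zero
    have := hdeg (s i) hmem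
    rw [hsdeg] at this
    omega
  have hmjj : m j = j := le_antisymm hmj (hmi j hjn.le hwj)
  -- `ℓ̄ = Σ bᵢ ȳᵢ`
  have hℓ : Ideal.Quotient.mk K (∑ i, a i * y i) ∈ Ideal.span (Set.range yb) := by
    rw [hyb, ← PinchTower.map_mk_maximalIdeal_eq K]
    refine Ideal.mem_map_of_mem _ (Ideal.sum_mem _ fun i _ => Ideal.mul_mem_left _ _ ?_)
    rw [← hy]; exact Ideal.subset_span ⟨i, rfl⟩
  obtain ⟨b, hb⟩ := Ideal.mem_span_range_iff_exists_fun.1 hℓ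
  -- the degree-`n` part `Pₙ` and the form `Λ = c̄·(Σ bᵢ Yᵢ)ⁿ`
  set Pn := homogeneousComponent n P with hPn
  set Λ : MvPolynomial (Fin (2 + e)) (A ⧸ K) :=
    C (Ideal.Quotient.mk K c) * (∑ i, C (b i) * X i) ^ n with hΛ
  have hΛh : Λ.IsHomogeneous n := by
    have h1 : (∑ i, C (b i) * X i : MvPolynomial (Fin (2 + e)) (A ⧸ K)).IsHomogeneous 1 := by
      refine IsHomogeneous.sum _ _ _ fun i _ => ?_
      simpa using (isHomogeneous_C _ (b i)).mul (isHomogeneous_X (A ⧸ K) i)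
    simpa using (isHomogeneous_C _ (Ideal.Quotient.mk K c)).mul (h1.pow n)
  have hΛev : eval yb Λ = Ideal.Quotient.mk K (c * (∑ i, a i * y i) ^ n) := by
    simp only [hΛ, map_mul, map_pow, eval_C, map_sum (eval yb), eval_X, ← hb]
  have hPnev : eval yb (Pn - Λ) ∈ maximalIdeal (A ⧸ K) ^ (n + 1) := by
    have h1 : eval yb (P - Pn) ∈ maximalIdeal (A ⧸ K) ^ (n + 1) := by
      have := eval_sub_homogeneousComponent_mem yb hdeg
      rwa [hyb] at this
    have h2 : eval yb P - eval yb Λ ∈ maximalIdeal (A ⧸ K) ^ (n + 1) := by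
      rw [hevalP, hΛev, ← map_sub]; exact hmK hca
    have : eval yb (Pn - Λ) = (eval yb P - eval yb Λ) - eval yb (P - Pn) := by
      simp only [map_sub]; ring
    rw [this]
    exact Ideal.sub_mem _ h2 h1
  have h0 := map_residue_eq_zero_of_eval_mem_pow_succ hdim yb hyb
    ((homogeneousComponent_isHomogeneous n P).sub hΛh) hPnev
  rw [map_sub, sub_eq_zero] at h0
  -- substitute `Y₀ ↦ X`, `Y₁ ↦ 1`, `Yᵢ ↦ 0` and compare `Xʲ`-coefficients
  set θ : Fin (2 + e) → Polynomial (ResidueField (A ⧸ K)) := fun l =>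
    if l = Fin.castAdd e 0 then Polynomial.X else if l = Fin.castAdd e 1 then 1 else 0 with hθ
  have hθ0 : θ (Fin.castAdd e 0) = Polynomial.X := by simp [hθ]
  have hθ1 : θ (Fin.castAdd e 1) = 1 := by simp [hθ, hi.symm]
  have key : (aeval θ (MvPolynomial.map (residue (A ⧸ K)) Pn)).coeff j =
      (aeval θ (MvPolynomial.map (residue (A ⧸ K)) Λ)).coeff j := by rw [hPn, h0]
  -- left side: the `Xʲ`-coefficient of `aeval θ P̄ₙ` is `w̄_j`
  have hmono : ∀ i, aeval θ (MvPolynomial.map (residue (A ⧸ K)) (monomial (s i) (W i))) =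
      Polynomial.C (residue (A ⧸ K) (W i)) * Polynomial.X ^ m i := by
    intro i
    rw [map_monomial, show monomial (s i) (residue (A ⧸ K) (W i)) =
      C (residue (A ⧸ K) (W i)) * X (Fin.castAdd e 0) ^ m i * X (Fin.castAdd e 1) ^ (n - i) by
        rw [hs, C_mul_X_pow_eq_monomial, X_pow_eq_monomial, monomial_mul, mul_one]]
    simp only [map_mul, map_pow, aeval_C, aeval_X, hθ0, hθ1, one_pow, mul_one, Polynomial.algebraMap_eq]
  have hPnsum : Pn = ∑ i ∈ (Finset.range (n + 1)).filter (fun i => m i + (n - i) = n),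
      monomial (s i) (W i) := by
    rw [hPn, hP, map_sum, Finset.sum_filter]
    refine Finset.sum_congr rfl fun i _ => ?_
    rw [homogeneousComponent_of_mem ((mem_homogeneousSubmodule _ _).2 (isHomogeneous_monomial _ (hsdeg i)))]
    by_cases h : m i + (n - i) = n
    · rw [if_pos h.symm, if_pos h]
    · rw [if_neg (Ne.symm h), if_neg h]
  have hL : (aeval θ (MvPolynomial.map (residue (A ⧸ K)) Pn)).coeff j = residue (A ⧸ K) (W j) := by
    rw [hPnsum, map_sum, map_sum, Polynomial.finsetSum_coeff]
    simp_rw [hmono, Polynomial.coeff_C_mul_X_pow]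
    rw [Finset.sum_eq_single j]
    · rw [hmjj, if_pos rfl]
    · intro i hi hne
      obtain ⟨hi1, hi2⟩ := Finset.mem_filter.1 hi
      have hmi' : m i = i := by have := Finset.mem_range.1 hi1; omega
      rw [hmi', if_neg (Ne.symm hne)]
    · intro h
      exact absurd (Finset.mem_filter.2 ⟨Finset.mem_range.2 (by omega), by rw [hmjj]; omega⟩) h
  -- right side: `c̄·(b̄₀ X + b̄₁)ⁿ`
  have hθ2 : ∀ l : Fin e, θ (Fin.natAdd 2 l) = 0 := fun l => by
    have h0 : Fin.natAdd 2 l ≠ Fin.castAdd e 0 :=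
      ne_of_apply_ne Fin.val (by simp only [Fin.val_natAdd, Fin.val_castAdd, Fin.val_zero]; omega)
    have h1 : Fin.natAdd 2 l ≠ Fin.castAdd e 1 :=
      ne_of_apply_ne Fin.val (by simp only [Fin.val_natAdd, Fin.val_castAdd, Fin.val_one]; omega)
    simp only [hθ, if_neg h0, if_neg h1]
  have hR : aeval θ (MvPolynomial.map (residue (A ⧸ K)) Λ) =
      Polynomial.C (residue (A ⧸ K) (Ideal.Quotient.mk K c)) *
        (Polynomial.C (residue (A ⧸ K) (b (Fin.castAdd e 0))) * Polynomial.X +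
          Polynomial.C (residue (A ⧸ K) (b (Fin.castAdd e 1)))) ^ n := by
    simp only [hΛ, map_mul, map_pow, map_add, map_C, map_sum, map_X, aeval_C, aeval_X, Polynomial.algebraMap_eq,
      Fin.sum_univ_add, Fin.sum_univ_two, hθ0, hθ1, hθ2, mul_one, mul_zero, Finset.sum_const_zero, add_zero]
  have hchoose : ((n.choose j : ℕ) : ResidueField (A ⧸ K)) = 0 := by
    have h1 : ((n.choose j : ℕ) : A ⧸ K) ∈ maximalIdeal (A ⧸ K) := by
      have := hmK (N := 1) (by rw [pow_one]; exact hguard)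
      rwa [pow_one, map_natCast] at this
    have := (residue_eq_zero_iff _).2 h1
    rwa [map_natCast] at this
  rw [hL, hR, Polynomial.coeff_C_mul, coeff_C_mul_X_add_C_pow _ _ _ hjn.le, hchoose, mul_zero, mul_zero,
    residue_eq_zero_iff] at key
  exact (notMem_maximalIdeal.2 (hwj.map (Ideal.Quotient.mk K))) key

end FibreLine

end Summit.ResolutionOfSingularities.ResolutionOfSingularities.Theorems.SplitTower
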